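import Literature.Geometry.Symplectic.TaubesCanonicalSolutionStepOne
import Literature.Geometry.GaugeTheory.SeibergWittenPerturbationNorm
import HarnessLib

/-!
# Taubes's pointwise bound `|ψ|² ≤ r + z` for the `r`-family of Seiberg–Witten equations of a
# symplectic `4`-manifold

Topic `Literature/Geometry/Symplectic`; continues `CanonicalSpincStructure` (the canonical `Spin^c`
structure `𝔰_J` of `(N, s, J)`, Taubes's perturbations `t·s`, the coefficient matrix `e⁰¹ + e²³` of
`s` in every unitary frame) and `TaubesCanonicalSolutionStepOne` (Taubes's perturbation `P₊F_{A₀}`,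
the canonical solution `(A₀, √r u₀)` of (5.2)) with `GaugeTheory/SeibergWittenPerturbationNorm` (Morgan's a priori
bound `|ψ(x)|² ≤ sup 2|η⁺| + sup κ⁻`, Prop. 6.4.1, and the seminorm `|η⁺(x)|`).

For Taubes's family of perturbed equations on a closed symplectic `4`-manifold — Taubes 1995, (5.2):
`D_A ψ = 0`, `P₊F_A = ¼τ(ψ ⊗ ψ*) + P₊F_{A₀} - (i/4) r ω`; in the tree's vocabulary the perturbation
`η₀ - (r/4)·s` of `(SW_η)` for the canonical `Spin^c` structure (any fixed `η₀`, Taubes's being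
`P₊F_{A₀}`) — the first a priori estimate of the large-`r` analysis is the **uniform pointwise bound
`|ψ|² ≤ r + z` with `z` independent of `r` and of the solution** (Taubes 1994, §2, proof of Lemma 3:
"(12) `2⁻¹d*d|ψ|² + |∇_Aψ|² + |ψ|⁴ = R(ψ, ∇_Aψ)` … uniform `L²` bounds for `ψ` and `|∇_A ψ|` and
uniform `L^∞` bounds for `ψ` follow by standard techniques"; in the rescaling `ψ = r^{1/2}(α u₀ + β)`
of Taubes 1995, (5.3), it reads `|α|² + |β|² ≤ 1 + z/r`).  Here it is obtained from the maximum
principle exactly as Morgan 1996, Prop. 6.4.1: `|ψ(x)|² ≤ 2|η⁺(x₀)| - κ(x₀)` at a maximum `x₀` of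
`|ψ|²`, and `|(η₀ - (r/4)s)⁺| ≤ |η₀⁺| + (r/4)|s⁺|` with **`|s⁺| = 2`** in the tree's normalisation
(`perturbationNorm_symplecticPerturbation`; the coefficient matrix of `s` is `e⁰¹ + e²³`), so that
the `r`-dependence is exactly `r` — the constant of Taubes's canonical solution `(A₀, √r u₀)`, for which
`|ψ|² ≡ r`.

* `perturbationNorm_symplecticPerturbation`: `|(t·s)⁺(x)| = 2|t|`;
* **`exists_forall_hermNormSq_le_normSq_add`**: there is `z ≥ 0` (depending on `(N, s, J)` and `η₀`
  only) such that every solution `(A, ψ)` of `(SW_η)` with `η = η₀ - (|c|²/4)·s` satisfies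
  `|ψ(x)|² ≤ |c|² + z` for all `x` (`r = |c|²`);
* `exists_forall_hermNormSq_le_taubes`: the case `η₀ = P₊F_{A₀}` of Taubes's family (5.2) (whose
  canonical solution `(A₀, c·u₀)` has `|ψ|² ≡ |c|²`).

PROVED, 0 named facts.

## References

* C. H. Taubes, *The Seiberg–Witten invariants and symplectic forms*, Math. Res. Lett. 1 (1994)
  809–822, §2 (8)–(13), proof of Lemma 3 (p. 813–814). [Taubes1994]
* C. H. Taubes, *The Seiberg–Witten and Gromov invariants*, Math. Res. Lett. 2 (1995) 221–238,
  §5 (5.2)–(5.3). [Taubes1995]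
* J. W. Morgan, *The Seiberg–Witten Equations and Applications to the Topology of Smooth
  Four-Manifolds*, Princeton Math. Notes 44 (1996), Prop. 6.4.1. [MorganSWBook1996]
-/

noncomputable section

open scoped Manifold ContDiff
open Set Complex Literature.Geometry.Kaehler Literature.Geometry.GaugeTheory Literature.Topology.FourManifolds
open Literature.Geometry.Lorentzian (PseudoRiemannianMetric)

namespace Literature.Geometry.Symplectic

namespace AlmostComplexStructure.IsCompatibleWith

variable {N : Type*} [TopologicalSpace N] [ChartedSpace (EuclideanSpace ℝ (Fin 4)) N]
  [IsManifold (𝓡 4) ∞ N] {J : AlmostComplexStructure (𝓡 4) ∞ N} {s : MForm (𝓡 4) N ℝ 2}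
  (h : J.IsCompatibleWith s) (hs : IsSmoothForm s)
  (hnd : ∀ x (v : TangentSpace (𝓡 4) x), v ≠ 0 → ∃ w : TangentSpace (𝓡 4) x, s x ![v, w] ≠ 0)

/-- **`|(t·s)⁺(x)| = 2|t|`**: in every frame of the canonical `Spin^c` structure the coefficient
matrix of `s` is `e⁰¹ + e²³`, whose self-dual coefficients are `(2, 0, 0)` (Taubes: "use a metric on
`X` where the symplectic form `ω` is self-dual with norm `√2`"). [cite: Taubes1995, §5 Step 1 (p. 233)] -/
theorem perturbationNorm_symplecticPerturbation (t : ℝ) (x₀ : N) {x : N}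
    (hx : x ∈ (h.canonicalSpincStructure hs hnd).baseSet x₀) :
    (h.canonicalSpincStructure hs hnd).perturbationNorm (h.symplecticPerturbation hs hnd t) x₀ x = 2 * |t| := by
  rw [SpincStructure.perturbationNorm, symplecticPerturbation_form, twoFormMatrix_smul',
    h.twoFormMatrix_canonicalSpincStructure hs hnd x₀ hx, sdCoeff_smul']
  have h2 : ∑ k : Fin 3, (t • sdCoeff !![0, 1, 0, 0; -1, 0, 0, 0; 0, 0, 0, 1; 0, 0, -1, 0]) k ^ 2 = (2 * |t|) ^ 2 := by
    simp [sdCoeff, Fin.sum_univ_three, mul_pow, sq_abs]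
    ring
  rw [h2]
  exact Real.sqrt_sq (by positivity)

/-- **Taubes's pointwise bound `|ψ|² ≤ r + z` for the `r`-family.**  On a closed symplectic
`4`-manifold `(N, s)` with compatible `J` (metric `g_J`, canonical `Spin^c` structure) and any fixed
perturbation `η₀` (Taubes: `P₊F_{A₀}`) there is a constant `z ≥ 0` such that for every `c ∈ ℂ` and
every (smooth) solution `(A, ψ)` of the Seiberg–Witten equations with perturbation `η₀ - (|c|²/4)·s`
— for `c = √r` the family (5.2) `P₊F_A = ¼τ(ψ ⊗ ψ*) + P₊F_{A₀} - (i/4) r ω` — one has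
`|ψ(x)|² ≤ |c|² + z` for all `x ∈ N`; equivalently `|α|² + |β|² ≤ 1 + z/r` for `ψ = √r(α u₀ + β)`.
Proof: Morgan's maximum principle bound `|ψ|² ≤ 2|η⁺(x₀)| - κ(x₀)` (Prop. 6.4.1) and
`2|η⁺| ≤ 2|η₀⁺| + 2·(|c|²/4)·|s⁺| = 2|η₀⁺| + |c|²`; `z = sup_N 2|η₀⁺| + sup_N κ⁻`.
[cite: Taubes1994, §2 proof of Lemma 3 ((12)–(13), p. 814)] -/
theorem exists_forall_hermNormSq_le_normSq_add [CompactSpace N] [(h.metric hs).HasLeviCivita]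
    (η₀ : (h.canonicalSpincStructure hs hnd).Perturbation) :
    ∃ z : ℝ, 0 ≤ z ∧ ∀ (c : ℂ) (cfg : (h.canonicalSpincStructure hs hnd).Configuration),
      SpincStructure.IsSolution (η₀ - h.symplecticPerturbation hs hnd (Complex.normSq c / 4)) cfg →
        ∀ x, cfg.spinor.hermNormSq x ≤ Complex.normSq c + z := by
  have hb1 : BddAbove (range fun y ↦ 2 * (h.canonicalSpincStructure hs hnd).perturbationNorm η₀
      ((h.canonicalSpincStructure hs hnd).indexAt y) y) := by
    obtain ⟨M, hM⟩ := (h.canonicalSpincStructure hs hnd).bddAbove_range_perturbationNorm η₀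
    refine ⟨2 * M, ?_⟩
    rintro _ ⟨y, rfl⟩
    have := hM ⟨y, rfl⟩
    dsimp only
    linarith
  have hz1 : 0 ≤ ⨆ y, 2 * (h.canonicalSpincStructure hs hnd).perturbationNorm η₀
      ((h.canonicalSpincStructure hs hnd).indexAt y) y :=
    Real.iSup_nonneg fun y ↦ by
      have := (h.canonicalSpincStructure hs hnd).perturbationNorm_nonneg η₀ ((h.canonicalSpincStructure hs hnd).indexAt y) y
      linarith
  have hz2 : 0 ≤ ⨆ y, max (-(h.metric hs).scalarCurvature y) 0 := Real.iSup_nonneg fun y ↦ le_max_right _ _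
  refine ⟨(⨆ y, 2 * (h.canonicalSpincStructure hs hnd).perturbationNorm η₀ ((h.canonicalSpincStructure hs hnd).indexAt y) y) +
      ⨆ y, max (-(h.metric hs).scalarCurvature y) 0, add_nonneg hz1 hz2, fun c cfg hsol x ↦ ?_⟩
  obtain ⟨x₀, h1, h2⟩ := (h.canonicalSpincStructure hs hnd).exists_forall_hermNormSq_le_perturbed hsol x
  have hi := (h.canonicalSpincStructure hs hnd).mem_baseSet_indexAt x₀
  have htri := (h.canonicalSpincStructure hs hnd).perturbationNorm_sub_le η₀
    (h.symplecticPerturbation hs hnd (Complex.normSq c / 4)) ((h.canonicalSpincStructure hs hnd).indexAt x₀) x₀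
  rw [h.perturbationNorm_symplecticPerturbation hs hnd _ _ hi,
    abs_of_nonneg (by linarith [Complex.normSq_nonneg c] : (0 : ℝ) ≤ Complex.normSq c / 4)] at htri
  have hle1 : 2 * (h.canonicalSpincStructure hs hnd).perturbationNorm η₀ ((h.canonicalSpincStructure hs hnd).indexAt x₀) x₀ ≤
      ⨆ y, 2 * (h.canonicalSpincStructure hs hnd).perturbationNorm η₀ ((h.canonicalSpincStructure hs hnd).indexAt y) y :=
    le_ciSup hb1 x₀
  have hle2 : max (-(h.metric hs).scalarCurvature x₀) 0 ≤ ⨆ y, max (-(h.metric hs).scalarCurvature y) 0 :=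
    le_ciSup (bddAbove_range_scalarCurvatureNeg (h.metric hs)) x₀
  have hc0 : 0 ≤ Complex.normSq c := Complex.normSq_nonneg c
  refine h1.trans (h2.trans (max_le ?_ ?_))
  · linarith [le_max_left (-(h.metric hs).scalarCurvature x₀) 0]
  · linarith

/-- **Taubes's bound for the family (5.2) itself** (`η₀ = P₊F_{A₀}`): there is `z ≥ 0` with
`|ψ(x)|² ≤ r + z` for every solution `(A, ψ)` of `D_Aψ = 0`, `P₊F_A = ¼τ(ψ ⊗ ψ*) + P₊F_{A₀} - (i/4) r ω`
(`r = |c|²`), every `r ≥ 0` and every `x` — while the canonical solution `(A₀, √r u₀)` has `|ψ|² ≡ r`.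
[cite: Taubes1994, §2 proof of Lemma 3 ((12)–(13), p. 814)] -/
theorem exists_forall_hermNormSq_le_taubes [CompactSpace N] [(h.metric hs).HasLeviCivita] :
    ∃ z : ℝ, 0 ≤ z ∧ ∀ (c : ℂ) (cfg : (h.canonicalSpincStructure hs hnd).Configuration),
      SpincStructure.IsSolution (h.taubesPerturbation hs hnd - h.symplecticPerturbation hs hnd (Complex.normSq c / 4)) cfg →
        ∀ x, cfg.spinor.hermNormSq x ≤ Complex.normSq c + z :=
  h.exists_forall_hermNormSq_le_normSq_add hs hnd _

end AlmostComplexStructure.IsCompatibleWith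

end Literature.Geometry.Symplectic

end
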